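import Summits.Ventures.YMGap.Census.TwistCensusSheetIntegral
import HarnessLib

/-!
# Venture YMGap, track (b) census — `2^{LᵢLⱼ} I(sheet) = 1`, `sheetMomentSum = |𝒱ᵢⱼ|`, and the germ law (G) on every 3-torus

HONEST FRAMING: venture file of the cell `pub-ymgap` (QuantumFields programme), track (b).  Exact statements about the
one-character census polynomials of `Census/TwistCensusObjects.lean` on a rectangular torus (any `d`, every side `≥ 1`);
nothing about root locations, limits or physics.  File 3 of 3 (`TwistCensusSheets` → `TwistCensusSheetIntegral` → this).

* `two_pow_mul_rectCharMoment_flatSheet` : **`2^{LᵢLⱼ} · I(flat sheet) = 1`** (rows merge to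
  `2^{−P} ∏_b χ(H_b) χ(H_{b+1}) = 2^{−P} ∏_b χ(H_b)²` by `TwistCensusSheetIntegral`, reindex `b + 1 → b`, and each line
  integrates to one) — Tomboulis's activity `c̃_{1/2}^{A}` of the minimal polymer, on the one-character ray;
* `sheetMomentSum_eq_card` : **`sheetMomentSum = |𝒱ᵢⱼ|`** (the identification of `TwistCensusSheets` + the sheet
  integral) — Tomboulis's count «there are `∏_{κ≠1,2} L_κ` such minimal clusters»; `twistCensusPoly_coeff_germ_eq_card` :
  `coeff_{P−1} Nᵢⱼ = −2·P·|𝒱ᵢⱼ|` for every rectangular `d`-torus and every plane;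
* `d = 3`: `card_rectVortexSheet_fin_three` (`|𝒱ᵢⱼ| = L_ρ`), `sheetMomentSum_eq_fin_three` (`sheetMomentSum = L_ρ`, the
  right-hand side of engine-1's `TwistCensusParityReductions.germLaw_iff`), and ★ `germLaw_fin_three`: BOTH conjuncts of
  `Conjectures.TwistCensusParity.GermLaw Ls i j ρ hij` («`coeff_k N = 0 (k + 1 < P)`, `coeff_{P−1} N = −2·P·L_ρ`»), stated
  here verbatim (the conjecture file is not imported), for every `L₀ × L₁ × L₂` with all sides `≥ 1` — the (G) column of
  the 127 census rows of HOME/engine/census/TwistCensusParity/, now a theorem.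

References: E. T. Tomboulis, arXiv:0707.2179 §6.2, p. 18: «The minimal cluster of this type consists of a single polymer which
is a 2-dimensional plane Π: x_μ = const., μ = 3, …, d … of size A = L₁L₂, and activity z(Π) = Σ_{half-int. j} c̃_j^A …
There are ∏_{κ≠1,2} L_κ such minimal clusters giving the leading contribution» [cite: Tomboulis2007Confinement, §6.2 p. 18];
HOME/STRUCTURE.md §4 N-3; HOME/engine/census/TwistCensusParity/ (evidence: (G) 127/127 rows).
-/

noncomputable section

open MeasureTheory Finset Real Function
open scoped BigOperators
open Literature.MathematicalPhysics.QuantumLattice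
open Literature.MathematicalPhysics.QuantumFieldTheory
open Literature.MathematicalPhysics.QuantumFieldTheory.Tomboulis2007
open Summit.Ventures.LatticeQCDFlow.Exactness
open Summit.Ventures.LatticeQCDFlow.Scoring

namespace Summit.Ventures.YMGap.Census

variable {d : ℕ} (Ls : Fin d → ℕ) [∀ i, NeZero (Ls i)]

variable {i j : Fin d} (hij : i < j)

/-! ### The sheet integral `2^{LᵢLⱼ} · I(flat sheet) = 1` -/

omit [∀ i, NeZero (Ls i)] in
/-- The character of a sheet plaquette in sheet coordinates (the holonomy's shifted base points are sheet sites). -/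
theorem rectPlaqChar_sheetPlaq (y : RectTorusSite Ls) (a : ZMod (Ls i)) (b : ZMod (Ls j)) (V : RectGaugeConfig Ls SU2) :
    rectPlaqChar V (sheetSite Ls i j y a b, ⟨(i, j), hij⟩) = sheetPlaqChar Ls i j y a b V := by
  simp only [rectPlaqChar, sheetPlaqChar, rectPlaquetteHolonomy, sheetSite_add_single_left, sheetSite_add_single_right]

/-- Products over `ℤ/n` as products over `range n` (plumbing). -/
private theorem prod_univ_zmod_eq_prod_range {n : ℕ} [NeZero n] {M : Type*} [CommMonoid M] (f : ZMod n → M) :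
    ∏ a : ZMod n, f a = ∏ a ∈ range n, f (a : ZMod n) := by
  have himg : (range n).image (fun a : ℕ => (a : ZMod n)) = univ := by
    ext z
    simp only [Finset.mem_image, Finset.mem_range, Finset.mem_univ, iff_true]
    exact ⟨z.val, z.val_lt, ZMod.natCast_zmod_val z⟩
  rw [← himg, Finset.prod_image]
  intro a ha c hc h
  have h' := (ZMod.natCast_eq_natCast_iff' a c n).1 h
  rwa [Nat.mod_eq_of_lt (Finset.mem_range.1 ha), Nat.mod_eq_of_lt (Finset.mem_range.1 hc)] at h'

/-- `I(flat sheet)` is the integral of the row products (reindex the sheet by its coordinates). -/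
theorem rectCharMoment_flatSheet_eq (y : RectTorusSite Ls) :
    rectCharMoment Ls (flatSheet Ls hij y) =
      ∫ V, ∏ b : ZMod (Ls j), ∏ a ∈ range (Ls i), sheetPlaqChar Ls i j y (a : ZMod (Ls i)) b V
        ∂(Measure.pi fun _ : RectEdge Ls => haarProbability SU2) := by
  unfold rectCharMoment
  refine integral_congr_ae (ae_of_all _ fun V => ?_)
  beta_reduce
  rw [flatSheet_eq_image, Finset.prod_image fun ab _ ab' _ h => sheetPlaq_injective Ls hij y h,
    Fintype.prod_prod_type_right]
  refine Finset.prod_congr rfl fun b _ => ?_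
  rw [prod_univ_zmod_eq_prod_range]
  exact Finset.prod_congr rfl fun a _ => rectPlaqChar_sheetPlaq Ls hij y _ b V

/-- **THE SHEET INTEGRAL: `2^{LᵢLⱼ} · I(flat sheet) = 1`** — the `SU(2)` character calculus on the flat `Lᵢ × Lⱼ` 2-torus:
rows merge to `2^{−LᵢLⱼ} ∏_b χ(H_b) χ(H_{b+1}) = 2^{−LᵢLⱼ} ∏_b χ(H_b)²`, and each line integrates to one.
[cite: Tomboulis2007Confinement, §6.2 (the minimal polymers Π after the activity z(Y)), p. 18] -/
theorem two_pow_mul_rectCharMoment_flatSheet (y : RectTorusSite Ls) :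
    (2 : ℝ) ^ (Ls i * Ls j) * rectCharMoment Ls (flatSheet Ls hij y) = 1 := by
  rw [rectCharMoment_flatSheet_eq]
  have h1 := integral_mul_prod_sheetRows Ls hij y univ (fun _ => (1 : ℝ)) continuous_const (fun _ _ _ _ _ => rfl)
  simp only [one_mul, Finset.card_univ, ZMod.card] at h1
  rw [h1]
  have h2 : ∀ V : RectGaugeConfig Ls SU2,
      ∏ b : ZMod (Ls j), (su2Char 1 (sheetLine Ls i j y b (Ls i) V) * su2Char 1 (sheetLine Ls i j y (b + 1) (Ls i) V)) =
        ∏ b : ZMod (Ls j), su2Char 1 (sheetLine Ls i j y b (Ls i) V) ^ 2 := by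
    intro V
    rw [Finset.prod_mul_distrib, Fintype.prod_equiv (Equiv.addRight 1)
      (fun b => su2Char 1 (sheetLine Ls i j y (b + 1) (Ls i) V)) (fun b => su2Char 1 (sheetLine Ls i j y b (Ls i) V))
      (fun _ => rfl), ← Finset.prod_mul_distrib]
    exact Finset.prod_congr rfl fun b _ => (sq _).symm
  simp_rw [h2]
  have h3 := integral_mul_prod_lineSq Ls hij y univ (fun _ => (1 : ℝ)) continuous_const (fun _ _ _ _ => rfl)
  simp only [one_mul] at h3
  rw [h3]
  simp

/-! ### Consequences: the sheet moment sum, the germ coefficient, and the germ law on 3-tori -/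

/-- **`sheetMomentSum = |𝒱ᵢⱼ|`** — the Haar-moment identity to which `TwistCensusGerm.twistCensusPoly_coeff_germ` reduces
the coefficient half of the germ law (G), for every rectangular torus and every plane. -/
theorem sheetMomentSum_eq_card : sheetMomentSum Ls hij = ((rectVortexSheet Ls i j hij).card : ℝ) := by
  rw [sheetMomentSum_eq_sum_rectVortexSheet,
    Finset.sum_congr rfl fun q _ => two_pow_mul_rectCharMoment_flatSheet Ls hij q.1]
  simp

/-- **The germ coefficient of the census polynomial**: `coeff_{LᵢLⱼ − 1} Nᵢⱼ = −2 · LᵢLⱼ · |𝒱ᵢⱼ|` for every rectangular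
`d`-torus and every plane `(i, j)`. -/
theorem twistCensusPoly_coeff_germ_eq_card :
    (twistCensusPoly Ls (rectVortexSheet Ls i j hij)).coeff (Ls i * Ls j - 1) =
      -2 * ((Ls i * Ls j : ℕ) : ℝ) * ((rectVortexSheet Ls i j hij).card : ℝ) := by
  rw [twistCensusPoly_coeff_germ, sheetMomentSum_eq_card]

/-- **On a 3-torus the twist stack `𝒱ᵢⱼ` has `L_ρ` plaquettes** (`ρ` the third direction): they are `(c e_ρ; i, j)`,
`c ∈ ℤ/L_ρ`. -/
theorem card_rectVortexSheet_fin_three (Ls : Fin 3 → ℕ) [∀ k, NeZero (Ls k)] {i j : Fin 3} (hij : i < j) (ρ : Fin 3)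
    (hρi : ρ ≠ i) (hρj : ρ ≠ j) : (rectVortexSheet Ls i j hij).card = Ls ρ := by
  have hthird : ∀ k : Fin 3, k ≠ i → k ≠ j → k = ρ := by
    intro k hki hkj
    have hij' := Fin.lt_def.1 hij
    apply Fin.ext
    have := k.isLt
    have := ρ.isLt
    have := i.isLt
    have := j.isLt
    rw [Ne, Fin.ext_iff] at hki hkj hρi hρj
    omega
  have himg : rectVortexSheet Ls i j hij =
      (univ : Finset (ZMod (Ls ρ))).image fun c => ((Pi.single ρ c, ⟨(i, j), hij⟩) : RectPlaquette Ls) := by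
    ext p
    rw [rectVortexSheet_eq_stackAt, mem_stackAt, Finset.mem_image]
    constructor
    · rintro ⟨hp2, hpi, hpj⟩
      refine ⟨p.1 ρ, Finset.mem_univ _, ?_⟩
      rcases p with ⟨z, P⟩
      simp only at hp2 hpi hpj ⊢
      rw [hp2]
      refine Prod.ext ?_ rfl
      funext k
      show (Pi.single ρ (z ρ) : RectTorusSite Ls) k = z k
      rcases eq_or_ne k i with rfl | hki
      · rw [hpi, Pi.single_eq_of_ne hρi.symm]
      · rcases eq_or_ne k j with rfl | hkj
        · rw [hpj, Pi.single_eq_of_ne hρj.symm]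
        · rw [hthird k hki hkj, Pi.single_eq_same]
    · rintro ⟨c, -, rfl⟩
      exact ⟨rfl, Pi.single_eq_of_ne hρi.symm _, Pi.single_eq_of_ne hρj.symm _⟩
  rw [himg, Finset.card_image_of_injective _ fun c c' h => ?_, Finset.card_univ, ZMod.card]
  have h' := congrFun (congrArg Prod.fst h) ρ
  simpa using h'

/-- **`sheetMomentSum = L_ρ` on a 3-torus** — the Haar-moment statement to which engine-1's reductions
(`Conjectures/TwistCensusParityReductions.germLaw_iff`) reduce the germ law (G). -/
theorem sheetMomentSum_eq_fin_three (Ls : Fin 3 → ℕ) [∀ k, NeZero (Ls k)] {i j : Fin 3} (hij : i < j) (ρ : Fin 3)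
    (hρi : ρ ≠ i) (hρj : ρ ≠ j) : sheetMomentSum Ls hij = (Ls ρ : ℝ) := by
  rw [sheetMomentSum_eq_card, card_rectVortexSheet_fin_three Ls hij ρ hρi hρj]

/-- **THE GERM LAW (G) ON EVERY 3-TORUS — both conjuncts of `Conjectures.TwistCensusParity.GermLaw Ls i j ρ hij`**
(stated verbatim; the conjecture file is not imported here): for every `L₀ × L₁ × L₂` (all sides `≥ 1`), every plane
`(i, j)` and its third axis `ρ`, `coeff_k Nᵢⱼ = 0` for `k + 1 < LᵢLⱼ` (`TwistCensusGerm.twistCensusPoly_coeff_eq_zero_of_lt`)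
and `coeff_{LᵢLⱼ−1} Nᵢⱼ = −2·LᵢLⱼ·L_ρ` (this file) — the (G) column of the 127 census rows of
HOME/engine/census/TwistCensusParity/, now a theorem. -/
theorem germLaw_fin_three (Ls : Fin 3 → ℕ) [∀ k, NeZero (Ls k)] (i j ρ : Fin 3) (hij : i < j) (hρi : ρ ≠ i)
    (hρj : ρ ≠ j) :
    (∀ k : ℕ, k + 1 < Ls i * Ls j → (twistCensusPoly Ls (rectVortexSheet Ls i j hij)).coeff k = 0) ∧
      (twistCensusPoly Ls (rectVortexSheet Ls i j hij)).coeff (Ls i * Ls j - 1) =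
        -(2 * ((Ls i * Ls j : ℕ) : ℝ) * (Ls ρ : ℝ)) := by
  refine ⟨fun _ hk => twistCensusPoly_coeff_eq_zero_of_lt Ls hij hk, ?_⟩
  rw [twistCensusPoly_coeff_germ_eq_card, card_rectVortexSheet_fin_three Ls hij ρ hρi hρj]
  ring

end Summit.Ventures.YMGap.Census

end
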